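import Mathlib

/-!
# TN-GR ANCHOR: zero first-order term ⇒ SECOND-ORDER finite-difference anchor letter (Schwarz lemma of order 2)

`CURRENCY-MEMO-g26.md` §10.10 note (critic #585 co-signed): `GRFlatEven.flatGradient_zero` ∕ ✓p794698 kill the DERIVATIVE of the organ's remainder at the
flat one-bond excitation; the finite-difference anchor letter `G` of `GROrganTelescope.firstDiff_window_path` for a window-size probe is then SECOND ORDER,
from (β)'s one-variable holomorphic extension with bounded oscillation.  This file is the one-variable analysis step, Mathlib only:
* ★ `norm_sub_le_of_deriv_eq_zero` — `h : ℂ → ℂ` holomorphic on `ball 0 ρ`, oscillation `‖h z − h 0‖ ≤ B` there, `deriv h 0 = 0` ⇒ `‖h z − h 0‖ ≤ B·(‖z‖∕ρ)²`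
  (Mathlib's higher-order Schwarz lemma `Complex.dist_le_mul_div_pow_of_mapsTo_ball_of_isLittleO`, `n = 1`).
* ★★ `anchor_secondOrder` — the REAL form the junction consumes: if `φ : ℝ → ℝ` agrees with `h` on `|s| < ρ` (`h ↑s = ↑(φ s)`) and `HasDerivAt φ 0 0`
  (the zero anchor), then `|φ s − φ 0| ≤ B·(|s|∕ρ)²` for `|s| < ρ`; with `ρ = r·θ` and a unit direction this is the anchor letter
  `G = (B∕r²)·(|s|∕θ)` times the size `|s|∕θ` — second order, as booked.
* `hasDerivAt_of_slice` ((iv) read off the slice), `deriv_zero_of_even`, ★★★ `anchor_secondOrder_of_even` — slice + evenness ⇒ second order, NO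
  differentiability hypothesis left.
HONEST: one-variable complex analysis; nothing about the runs; the (β) predicate is an interface no density is shown to inhabit; nothing of O1∕O1ᵘ-H∕S3∕20520∕
`YM3TorusSU2` proved; registry №36 intact; R3 = SU(2) YM₃ on T³ — NOT d = 4, NOT infinite volume, NOT a mass gap, NOT Clay.
-/

namespace Summit.QuantumFields.YangMills.Cruxes.FluctuationComparisonRegPrIntL.GRAnchor

open Metric Set Asymptotics Filter Topology

/-- ★ ORDER-TWO SCHWARZ: holomorphic on `ball 0 ρ`, oscillation `≤ B`, `deriv h 0 = 0` ⇒ `‖h z − h 0‖ ≤ B·(‖z‖∕ρ)²`. -/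
theorem norm_sub_le_of_deriv_eq_zero {h : ℂ → ℂ} {ρ B : ℝ} (hd : DifferentiableOn ℂ h (ball 0 ρ))
    (hB : ∀ z ∈ ball (0 : ℂ) ρ, ‖h z - h 0‖ ≤ B) (h0 : deriv h 0 = 0) {z : ℂ} (hz : z ∈ ball (0 : ℂ) ρ) :
    ‖h z - h 0‖ ≤ B * (‖z‖ / ρ) ^ 2 := by
  have hρ : 0 < ρ := nonempty_ball.mp ⟨_, hz⟩
  have hmaps : MapsTo h (ball 0 ρ) (closedBall (h 0) B) := by
    intro w hw
    rw [mem_closedBall, dist_eq_norm]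
    exact hB w hw
  have hder : HasDerivAt h 0 0 := by
    have := (hd.differentiableAt (ball_mem_nhds (0 : ℂ) hρ)).hasDerivAt
    rwa [h0] at this
  have hn : (fun w => h w - h 0) =o[𝓝 (0 : ℂ)] fun w => ‖w - 0‖ ^ 1 := by
    have h1 := hder.hasFDerivAt.isLittleO
    have h1' : (fun w => h w - h 0) =o[𝓝 (0 : ℂ)] fun w => w - 0 :=
      h1.congr_left (fun w => by simp)
    exact h1'.trans_isBigO (by simpa using (isBigO_refl (fun w : ℂ => w - 0) (𝓝 (0 : ℂ))).norm_right)
  have hmain := Complex.dist_le_mul_div_pow_of_mapsTo_ball_of_isLittleO hd hmaps hn hz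
  rw [dist_eq_norm, dist_eq_norm, sub_zero] at hmain
  simpa using hmain

/-- ★★ THE REAL ANCHOR LETTER: `φ` agrees with the holomorphic `h` on `|s| < ρ`, `φ′(0) = 0` ⇒ `|φ s − φ 0| ≤ B·(|s|∕ρ)²`. -/
theorem anchor_secondOrder {h : ℂ → ℂ} {ρ B : ℝ} (hd : DifferentiableOn ℂ h (ball 0 ρ))
    (hB : ∀ z ∈ ball (0 : ℂ) ρ, ‖h z - h 0‖ ≤ B) {φ : ℝ → ℝ} (hφ : ∀ s : ℝ, |s| < ρ → h (s : ℂ) = ((φ s : ℝ) : ℂ))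
    (hφ' : HasDerivAt φ 0 0) {s : ℝ} (hs : |s| < ρ) :
    |φ s - φ 0| ≤ B * (|s| / ρ) ^ 2 := by
  have hρ : 0 < ρ := lt_of_le_of_lt (abs_nonneg s) hs
  -- the complex derivative of `h` at `0` is the real derivative of its restriction, which is `φ`'s, which is `0`
  have hderh : HasDerivAt h (deriv h 0) 0 := (hd.differentiableAt (ball_mem_nhds (0 : ℂ) hρ)).hasDerivAt
  have hres : HasDerivAt (fun y : ℝ => h (y : ℂ)) (deriv h 0) 0 := by
    simpa using hderh.comp_ofReal
  have hφc : HasDerivAt (fun y : ℝ => ((φ y : ℝ) : ℂ)) ((0 : ℝ) : ℂ) 0 := hφ'.ofReal_comp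
  have heq : (fun y : ℝ => h (y : ℂ)) =ᶠ[𝓝 (0 : ℝ)] fun y : ℝ => ((φ y : ℝ) : ℂ) := by
    have hopen : {y : ℝ | |y| < ρ} ∈ 𝓝 (0 : ℝ) := by
      have : {y : ℝ | |y| < ρ} = ball (0 : ℝ) ρ := by ext y; simp
      rw [this]; exact ball_mem_nhds _ hρ
    exact Filter.mem_of_superset hopen (fun y hy => hφ y hy)
  have hres' : HasDerivAt (fun y : ℝ => ((φ y : ℝ) : ℂ)) (deriv h 0) 0 := hres.congr_of_eventuallyEq heq.symm
  have h0 : deriv h 0 = 0 := by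
    have := hres'.unique hφc
    simpa using this
  have hz : ((s : ℂ)) ∈ ball (0 : ℂ) ρ := by
    simpa [dist_eq_norm, Complex.norm_real] using hs
  have hmain := norm_sub_le_of_deriv_eq_zero hd hB h0 hz
  have h00 : h 0 = ((φ 0 : ℝ) : ℂ) := by simpa using hφ 0 (by simpa using hρ)
  rw [hφ s hs, h00, ← Complex.ofReal_sub, Complex.norm_real, Complex.norm_real, Real.norm_eq_abs, Real.norm_eq_abs] at hmain
  exact hmain


/-! ## (iv) from the slice, and the combined anchor: evenness + holomorphic slice ⇒ second order (no differentiability hypothesis left) -/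

/-- (iv) DISCHARGED MODULO (β): if `φ` agrees with a function `h` holomorphic on `ball 0 ρ` along the reals near `0`, then `φ` is differentiable at `0`
(with derivative `(deriv h 0).re`). -/
theorem hasDerivAt_of_slice {h : ℂ → ℂ} {ρ : ℝ} (hρ : 0 < ρ) (hd : DifferentiableOn ℂ h (ball 0 ρ))
    {φ : ℝ → ℝ} (hφ : ∀ s : ℝ, |s| < ρ → h (s : ℂ) = ((φ s : ℝ) : ℂ)) :
    HasDerivAt φ (deriv h 0).re 0 := by
  have hderh : HasDerivAt h (deriv h 0) 0 := (hd.differentiableAt (ball_mem_nhds (0 : ℂ) hρ)).hasDerivAt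
  have hres : HasDerivAt (fun y : ℝ => h (y : ℂ)) (deriv h 0) 0 := by
    simpa using hderh.comp_ofReal
  have hre : HasDerivAt (fun y : ℝ => (h (y : ℂ)).re) (deriv h 0).re 0 := by
    simpa using hderh.real_of_complex
  have heq : (fun y : ℝ => (h (y : ℂ)).re) =ᶠ[𝓝 (0 : ℝ)] φ := by
    have hopen : {y : ℝ | |y| < ρ} ∈ 𝓝 (0 : ℝ) := by
      have : {y : ℝ | |y| < ρ} = ball (0 : ℝ) ρ := by ext y; simp
      rw [this]; exact ball_mem_nhds _ hρ
    exact Filter.mem_of_superset hopen (fun y hy => by simp [hφ y hy])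
  exact hre.congr_of_eventuallyEq heq.symm

/-- An even real function differentiable at `0` has zero derivative there (one-variable form of `GREven.fderiv_zero_of_even`). -/
theorem deriv_zero_of_even {φ : ℝ → ℝ} {d : ℝ} (hφ : HasDerivAt φ d 0) (heven : ∀ s, φ (-s) = φ s) : d = 0 := by
  have h1 : HasDerivAt (fun s => φ (-s)) (-d) 0 := by
    have h' : HasDerivAt φ d (-0 : ℝ) := by simpa using hφ
    have := h'.scomp (0 : ℝ) (hasDerivAt_neg (0 : ℝ))
    simpa [Function.comp_def] using this
  have h2 : (fun s => φ (-s)) = φ := funext heven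
  rw [h2] at h1
  have := hφ.unique h1
  linarith

/-- ★★★ THE ANCHOR, ALL INPUTS NAMED: holomorphic slice with oscillation `≤ B` on `ball 0 ρ` (the `t = 0` slice of (β)), agreement with the real one-bond
excitation function `φ`, and EVENNESS of `φ` (global gauge symmetry: ✓p794698 ∕ `GRFlatEven.flat_excitation_even`) ⇒ `|φ s − φ 0| ≤ B·(|s|∕ρ)²`.
No differentiability hypothesis remains: (iv) is read off the slice. -/
theorem anchor_secondOrder_of_even {h : ℂ → ℂ} {ρ B : ℝ} (hd : DifferentiableOn ℂ h (ball 0 ρ))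
    (hB : ∀ z ∈ ball (0 : ℂ) ρ, ‖h z - h 0‖ ≤ B) {φ : ℝ → ℝ} (hφ : ∀ s : ℝ, |s| < ρ → h (s : ℂ) = ((φ s : ℝ) : ℂ))
    (heven : ∀ s, φ (-s) = φ s) {s : ℝ} (hs : |s| < ρ) :
    |φ s - φ 0| ≤ B * (|s| / ρ) ^ 2 := by
  have hρ : 0 < ρ := lt_of_le_of_lt (abs_nonneg s) hs
  have hder := hasDerivAt_of_slice hρ hd hφ
  have h0 : (deriv h 0).re = 0 := deriv_zero_of_even hder heven
  rw [h0] at hder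
  exact anchor_secondOrder hd hB hφ hder hs

end Summit.QuantumFields.YangMills.Cruxes.FluctuationComparisonRegPrIntL.GRAnchor
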